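import Mathlib
import Literature.MathematicalPhysics.QuantumFieldTheory.Balaban1983to89.B6FromB4
import Literature.MathematicalPhysics.QuantumFieldTheory.Balaban1983to89.B6BondElimination

/-!
# `Balaban1983to89.B6WeightedEncoding` — the "routine encoding" of a weighted multi-scale variable set as a unit
lattice operator of [3], PERFORMED (B6 = T. Bałaban, *Propagators and renormalization transformations for lattice
gauge theories. II*, Commun. Math. Phys. **96**, 223–250 (1984) [Balaban1984PropagatorsII]; [3] = B4 =
[Balaban1983RegularityDecay], Sect. 5 Theorem p. 594)

CITATION HEADER (lean-in-tree rule 2026-08-18).  Cell `pub-balaban`, unit `b2b-balaban-b06-g3` (paper sub-cell B06,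
gen 3).  Sibling of `…B6FromB4` (unit pv09-g2), whose use-site theorems `useSites_uniform` / `cubeSites_uniform` /
`ineq279_281_of_sect5` / `ineq2148_of_sect5` carry the NAMED hypothesis `UseSite.Encodes K σ` — in the words of that
module, the *"routine encoding of a multi-scale bond/site set with the weighted products (2.69) as Ω ⊂ Z^d, functions
R^N-valued"* of the cell's census rows G-B6-05a / G-B6-12 (ii), *"NAMED, not performed"*.  THIS MODULE PERFORMS IT,
generically and sorry-free: for every finite family of real variables indexed by a type S, carrying weights
w : S → [1, W] and placed injectively in Ω × Fin N by ι, and every operator M on ℓ²(S, w) that is self-adjoint for the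
weighted product, bounded below by γ₀ in it and has an exponentially decaying kernel, the conjugated-and-padded matrix
`encode ι w M γ₀` on Ω × Fin N satisfies condition (5.6) of [3] (`encode_hyp56`), its inverse restricted to ι(S) is the
conjugate of M⁻¹ (`encode_inv_apply`), the use site it defines satisfies `UseSite.Encodes √W 1` (`WSite.encodes`), and
therefore the Sect. 5 Theorem of [3] (uniform reading, `B4.Sect5ThmUniform`) gives ONE O(1) and ONE rate for the decay
of M⁻¹ over ALL such sites (`weightedSites_uniform`); the (S1)/(S4) family statements of `…B6FromB4` follow with the
encoding hypothesis DISCHARGED (`ineq279_281_of_weighted`, `ineq2148_of_weighted`).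

THE PRINTED SITES (quoted from the renders `1984-cmp96-propagators-rt-II-p013-x2.png`, `…-p015-x2.png`, `…-p026-x2.png`).
* p. 235 [PDF 13], (2.69): *"The inequalities (2.67), (2.68) suggest that we should consider the operator Q′G′²Q′* on
  a Hilbert space L²(𝔅) defined by the scalar product ⟨λ, λ′⟩ = Σ_{j=0}^k Σ_{y∈Λ_j} (L^jη)^d λ(y)λ′(y). (2.69)"*; and
  before (2.71): *"We assume that either □̃ ⊂ B^j(Λ_j), or it intersects B^{j+1}(Λ_{j+1}) also. We have for ω defined
  on 𝔅∩□ (outside this set we put ω equal to 0)"*.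
* (S1) p. 237 [PDF 15]: *"Of course we have also a bound from above and an exponential decay of the kernel of
  Q′G′^ξ(□̃)²Q′* with the decay rate δ₀. Hence the operator C^ξ_□ is bounded from above and below by absolute
  constants. We can use the theory developed in Sect. 5 [3] to conclude that it has an exponential decay with a decay
  rate δ₁ depending on δ₀ and the bound γ₀."* … *"Thus we have |C^ξ_□(y, y′)| ≤ O(1)e^{−δ₁|y−y′|} (2.79) for y, y′
  belonging to 𝔅∩□ rescaled to unit scale."*
* (S4) p. 248 [PDF 26]: *"Finally let us consider the operator QGQ* and its inverse. We consider these operators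
  on the L²-space defined by (2.69) with sites replaced by bonds."* … *"Keeping the same notations as before we
  consider the operators C_□ = ((QG_□Q*)↾_□)^{−1}, C = Σ_{□∈𝒟} h_□C_□h_□. (2.143) At first let us investigate bounds on
  C_□. We assume that we have the same geometric situation as previously, so"* (2.144) *"where Q″ is defined, as in
  (2.119), by the quadratic form in B in the expression (2.112), and the last scalar product above is on the unit
  scale. We put B equal to 0 outside □"* … *"⟨B, (QG_□Q*)↾_□B⟩ ≥ γ₀‖B‖² (2.147) with a positive constant γ₀ depending
  on d and L only."*  (v1.1 DOCFIX 2026-08-18, XREAD `b2b-balaban-ref5` C-ref5-31: v1 presented the paraphrase "Let us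
  take the j^th term in (2.142) and □ ∈ 𝒟_j" in quotation marks; it is not printed on p. 248 and is replaced here by
  the printed sentences; no declaration changed.)
So at both sites the variables live on a finite TWO-SCALE set (points, resp. bonds, of Λ_j∩□ on the L^jη-lattice and
of Λ_{j+1}∩□ on the L^{j+1}η-lattice, rescaled by (L^jη)^{−1} to the unit lattice ℤ^d and its sublattice Lℤ^d), the
scalar product is (2.69), whose weights on the unit scale of the finer lattice are (L^{j′−j})^d ∈ {1, L^d}, and the
operator to which [3] is applied is self-adjoint and bounded below (by γ₀², (2.78); by γ₀, (2.147)) in THAT product.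
[3] is printed for *"a symmetric operator defined on the space L²(Ω) of functions φ : Ω → R^N"*, Ω ⊂ Z^d, with the
unweighted product (`B4.Hyp56`, `B4.Idx Ω N = ↥Ω × Fin N`).

WHAT IS KERNEL-CHECKED (pure finite-dimensional linear algebra; no leaf, no named fact).
1. `conj w M = D M D⁻¹`, D = diag(√w) (`conj_eq_diagonal_mul`): `det_conj`, `conj_mul`, `conj_one`, `conj_inv`
   ((DMD⁻¹)⁻¹ = DM⁻¹D⁻¹), `conj_isSymm` (weighted self-adjointness w(y)M(y,y′) = w(y′)M(y′,y) ⇒ symmetric),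
   `conj_lower` (⟨u, Mu⟩_w ≥ γ‖u‖²_w ⇒ DMD⁻¹ ≥ γ), `conj_decay` (|DMD⁻¹(y,y′)| ≤ √W·c·e^{…} if 1 ≤ w ≤ W).
2. Transport along an injection ι : S ↪ Ω × Fin N and padding by γ on the unused indices (`encode`, built on
   `B6BondElimination.pad`): `encode_apply`, `encode_hyp56` ((5.6) with (γ, √W·c + γ, δ)), `encode_inv_apply`.
3. `WSite` / `WSite.Printed W γ₀ c₀ δ₀` (the printed data and hypotheses of one site: weights in [1, W], weighted
   self-adjointness, the DISPLAYED lower bound, the ASSERTED kernel decay in the sup-distance of the encoded positions),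
   `WSite.toUseSite`, `WSite.hyp56`, `WSite.encodes` (`UseSite.Encodes √W 1` — DISCHARGED), `weightedSites_uniform`
   (from `B4.Sect5ThmUniform`: ∃ O(1), δ for all sites: |M⁻¹(y, y′)| ≤ O(1)e^{−δ|ιy−ιy′|}), and the family forms
   `ineq279_281_of_weighted` / `ineq2148_of_weighted` = `B6FromB4.ineq279_281_of_sect5` / `ineq2148_of_sect5` with
   `henc` and `h278`/`h2147` replaced by the printed weighted hypotheses.

TYPING REMARKS (cell DIVERGENCE D-b06.13).  (a) Kernels: B6 composes kernels with the weights of the summation variable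
((2.83): *"Σ_{y″} (L^{j′}η)^d (Q′G′²Q′*)(y, y″)h_{□′}(y″)C_{□′}(y″, y′)"*), i.e. kernel = matrix entry / w(y′); the module
states everything for MATRIX entries (M acting as (Mλ)(y) = Σ_{y′} M(y, y′)λ(y′)); with 1 ≤ w ≤ W the two conventions
differ by factors in [W⁻¹, 1] on the hypothesis side (absorbed in c₀) and only IMPROVE the conclusion (`abs_div_weight_le`).
Normalising the smallest weight to 1 is free: the hypotheses `symm`/`lower` are invariant under a common rescaling of
w.  (b) Distances: B6's |y − y′| for the rescaled points is typed, as in [3] (`B4.Hyp56`, D-b04), as the sup-distance of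
the encoded positions in ℤ^d (the rescaled L^jη- and L^{j+1}η-lattice points ARE points of ℤ^d, resp. Lℤ^d ⊂ ℤ^d); a
euclidean reading changes the rates by √d.  For bonds, position = starting point, component = direction (N = d), or
N = 2d with the scale as part of the component index, which makes ι injective with no geometric discussion; the
module keeps ι abstract (any injection), so both fit.  (c) T-tori ↦ ℤ^d regions as in D-pv09g2.2 / D-b06.10–12 (the
operators at (S1)/(S4) are restricted to a cube □, p. 248: *"We put B equal to 0 outside □"*).  (d) What this module
does NOT touch: the kernel-decay hypotheses on the operators themselves (asserted in print, not displayed — they stay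
the named field `WSite.Printed.decay`), the lower bounds (2.78)/(2.147) (displayed; (2.147)'s undisplayed step is the
sibling `…B6AdjointAveraging`), the scaling laws (2.80)/(2.144) (kept as the hypotheses `ht`/`hscale` of
`B6FromB4.cubeSites_uniform`), and the random walks (2.82)–(2.87).

Value = kernel certificate of one elementary undisplayed step (the cell's "routine encoding"), NOT summit progress.
-/

namespace Literature.MathematicalPhysics.QuantumFieldTheory.Balaban1983to89.B6WeightedEncoding

open Literature.MathematicalPhysics.QuantumFieldTheory.Balaban1983to89
open Finset
open scoped Matrix

/-! ## §1  Conjugation by the square roots of the weights -/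

section Conj

variable {S : Type}

/-- √w(y). [folklore] -/
noncomputable def sw (w : S → ℝ) (y : S) : ℝ := Real.sqrt (w y)

/-- √w > 0 for positive weights. [folklore] -/
theorem sw_pos {w : S → ℝ} (hw : ∀ y, 0 < w y) (y : S) : 0 < sw w y := Real.sqrt_pos.mpr (hw y)

/-- √w ≠ 0. [folklore] -/
theorem sw_ne {w : S → ℝ} (hw : ∀ y, 0 < w y) (y : S) : sw w y ≠ 0 := (sw_pos hw y).ne'

/-- √w·√w = w. [folklore] -/
theorem sw_mul_self {w : S → ℝ} (hw : ∀ y, 0 < w y) (y : S) : sw w y * sw w y = w y :=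
  Real.mul_self_sqrt (hw y).le

/-- 1 ≤ w ⇒ 1 ≤ √w. [folklore] -/
theorem one_le_sw {w : S → ℝ} (h1 : ∀ y, 1 ≤ w y) (y : S) : 1 ≤ sw w y := by
  rw [sw, ← Real.sqrt_one]
  exact Real.sqrt_le_sqrt (h1 y)

/-- w ≤ W ⇒ √w ≤ √W. [folklore] -/
theorem sw_le {w : S → ℝ} {W : ℝ} (hW : ∀ y, w y ≤ W) (y : S) : sw w y ≤ Real.sqrt W :=
  Real.sqrt_le_sqrt (hW y)

/-- The conjugated matrix D M D⁻¹, D = diag(√w): entry √w(y)·M(y, y′)/√w(y′).  (The matrix of the operator M of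
ℓ²(S, w) in the orthonormal coordinates v = Dλ.) [folklore] -/
noncomputable def conj (w : S → ℝ) (M : Matrix S S ℝ) : Matrix S S ℝ :=
  Matrix.of fun y y' => sw w y * M y y' / sw w y'

/-- Entries of `conj`. [folklore] -/
theorem conj_apply (w : S → ℝ) (M : Matrix S S ℝ) (y y' : S) :
    conj w M y y' = sw w y * M y y' / sw w y' := rfl

/-- Self-adjointness for the weighted product ⟨λ, λ′⟩_w = Σ w λ λ′ (w(y)M(y, y′) = w(y′)M(y′, y)) makes D M D⁻¹
symmetric. [folklore] -/
theorem conj_isSymm {w : S → ℝ} (hw : ∀ y, 0 < w y) {M : Matrix S S ℝ}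
    (hM : ∀ y y', w y * M y y' = w y' * M y' y) : (conj w M).IsSymm := by
  refine Matrix.IsSymm.ext fun y y' => ?_
  rw [conj_apply, conj_apply, div_eq_div_iff (sw_ne hw y) (sw_ne hw y')]
  calc sw w y' * M y' y * sw w y' = (sw w y' * sw w y') * M y' y := by ring
    _ = w y' * M y' y := by rw [sw_mul_self hw]
    _ = w y * M y y' := (hM y y').symm
    _ = (sw w y * sw w y) * M y y' := by rw [sw_mul_self hw]
    _ = sw w y * M y y' * sw w y := by ring

/-- KERNEL-CHECKED: with weights in [1, W], an entrywise bound |M(y, y′)| ≤ c·e(y, y′) gives |D M D⁻¹(y, y′)| ≤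
√W·c·e(y, y′). [folklore] -/
theorem conj_decay {w : S → ℝ} (hw : ∀ y, 0 < w y) (h1 : ∀ y, 1 ≤ w y) {W : ℝ} (hW : ∀ y, w y ≤ W)
    {M : Matrix S S ℝ} {c : ℝ} {e : S → S → ℝ} (hM : ∀ y y', |M y y'| ≤ c * e y y')
    (y y' : S) : |conj w M y y'| ≤ Real.sqrt W * c * e y y' := by
  rw [conj_apply, abs_div, abs_mul, abs_of_pos (sw_pos hw y), abs_of_pos (sw_pos hw y')]
  calc sw w y * |M y y'| / sw w y' ≤ sw w y * |M y y'| :=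
        div_le_self (mul_nonneg (sw_pos hw y).le (abs_nonneg _)) (one_le_sw h1 y')
    _ ≤ Real.sqrt W * (c * e y y') :=
        mul_le_mul (sw_le hW y) (hM y y') (abs_nonneg _) (Real.sqrt_nonneg _)
    _ = Real.sqrt W * c * e y y' := by ring

/-- Typing remark (a): dividing a kernel by a weight ≥ 1 only decreases its absolute value. [folklore] -/
theorem abs_div_weight_le {x t : ℝ} (ht : 1 ≤ t) : |x / t| ≤ |x| := by
  rw [abs_div, abs_of_pos (lt_of_lt_of_le one_pos ht)]
  exact div_le_self (abs_nonneg x) ht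

variable [Fintype S]

/-- D M D⁻¹ · D M′ D⁻¹ = D (MM′) D⁻¹. [folklore] -/
theorem conj_mul {w : S → ℝ} (hw : ∀ y, 0 < w y) (M M' : Matrix S S ℝ) :
    conj w M * conj w M' = conj w (M * M') := by
  ext y y'
  simp only [Matrix.mul_apply, conj_apply]
  rw [Finset.mul_sum, Finset.sum_div]
  refine Finset.sum_congr rfl fun z _ => ?_
  rw [div_mul_div_comm, div_eq_div_iff (mul_ne_zero (sw_ne hw z) (sw_ne hw y')) (sw_ne hw y')]
  ring

/-- (D M D⁻¹ v)(y) = √w(y)·(M(D⁻¹v))(y). [folklore] -/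
theorem conj_mulVec (w : S → ℝ) (M : Matrix S S ℝ) (v : S → ℝ) (y : S) :
    (conj w M *ᵥ v) y = sw w y * (M *ᵥ fun y' => v y' / sw w y') y := by
  simp only [Matrix.mulVec, dotProduct, conj_apply, Finset.mul_sum]
  exact Finset.sum_congr rfl fun y' _ => by ring

/-- The quadratic form of D M D⁻¹ at v is the WEIGHTED quadratic form of M at u = D⁻¹v. [folklore] -/
theorem conj_quadForm {w : S → ℝ} (hw : ∀ y, 0 < w y) (M : Matrix S S ℝ) (v : S → ℝ) :
    ∑ y, v y * (conj w M *ᵥ v) y =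
      ∑ y, w y * (v y / sw w y) * (M *ᵥ fun y' => v y' / sw w y') y := by
  refine Finset.sum_congr rfl fun y _ => ?_
  rw [conj_mulVec, ← mul_assoc]
  have h : v y * sw w y = w y * (v y / sw w y) := by
    rw [mul_div_assoc', eq_div_iff (sw_ne hw y), ← sw_mul_self hw y]
    ring
  rw [h]

/-- KERNEL-CHECKED: a lower bound γ of M in the weighted product — ⟨u, Mu⟩_w ≥ γ‖u‖²_w, the form in which B6 displays
(2.78) and (2.147) — is a lower bound γ of D M D⁻¹ in the unweighted product of [3] (5.6). [folklore] -/
theorem conj_lower {w : S → ℝ} (hw : ∀ y, 0 < w y) {M : Matrix S S ℝ} {γ : ℝ}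
    (hM : ∀ u : S → ℝ, γ * ∑ y, w y * u y ^ 2 ≤ ∑ y, w y * u y * (M *ᵥ u) y) (v : S → ℝ) :
    γ * ∑ y, v y ^ 2 ≤ ∑ y, v y * (conj w M *ᵥ v) y := by
  rw [conj_quadForm hw]
  have h : ∑ y, v y ^ 2 = ∑ y, w y * (v y / sw w y) ^ 2 := by
    refine Finset.sum_congr rfl fun y _ => ?_
    rw [div_pow, sq (sw w y), sw_mul_self hw, mul_div_assoc', mul_div_cancel_left₀ _ (hw y).ne']
  rw [h]
  exact hM _

variable [DecidableEq S]

/-- `conj w M = diag(√w) · M · diag(1/√w)`. [folklore] -/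
theorem conj_eq_diagonal_mul (w : S → ℝ) (M : Matrix S S ℝ) :
    conj w M = Matrix.diagonal (sw w) * M * Matrix.diagonal fun y => (sw w y)⁻¹ := by
  ext y y'
  rw [Matrix.mul_diagonal, Matrix.diagonal_mul, conj_apply, div_eq_mul_inv]

/-- det (D M D⁻¹) = det M. [folklore] -/
theorem det_conj {w : S → ℝ} (hw : ∀ y, 0 < w y) (M : Matrix S S ℝ) : (conj w M).det = M.det := by
  rw [conj_eq_diagonal_mul, Matrix.det_mul, Matrix.det_mul, Matrix.det_diagonal, Matrix.det_diagonal]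
  have h : (∏ y, sw w y) * ∏ y, (sw w y)⁻¹ = 1 := by
    rw [← Finset.prod_mul_distrib]
    exact Finset.prod_eq_one fun y _ => mul_inv_cancel₀ (sw_ne hw y)
  calc (∏ y, sw w y) * M.det * ∏ y, (sw w y)⁻¹ = ((∏ y, sw w y) * ∏ y, (sw w y)⁻¹) * M.det := by ring
    _ = M.det := by rw [h, one_mul]

omit [Fintype S] in
/-- D 1 D⁻¹ = 1. [folklore] -/
theorem conj_one {w : S → ℝ} (hw : ∀ y, 0 < w y) : conj w (1 : Matrix S S ℝ) = 1 := by
  ext y y'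
  rw [conj_apply, Matrix.one_apply]
  by_cases h : y = y'
  · subst h
    rw [if_pos rfl, mul_one, div_self (sw_ne hw y)]
  · rw [if_neg h, mul_zero, zero_div]

/-- (D M D⁻¹)⁻¹ = D M⁻¹ D⁻¹ for invertible M. [folklore] -/
theorem conj_inv {w : S → ℝ} (hw : ∀ y, 0 < w y) {M : Matrix S S ℝ} (hM : IsUnit M.det) :
    (conj w M)⁻¹ = conj w M⁻¹ := by
  apply Matrix.inv_eq_right_inv
  rw [conj_mul hw, Matrix.mul_nonsing_inv _ hM, conj_one hw]

end Conj

/-! ## §2  Transport along an injection ι : S ↪ Ω × Fin N and padding -/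

section Transport

variable {d N : ℕ} {Ω : Finset (Fin d → ℤ)} {S : Type} [Fintype S]

/-- The set ι(S) of used indices. [folklore] -/
def rng (ι : S ↪ B4.Idx Ω N) : Finset (B4.Idx Ω N) := Finset.univ.map ι

/-- ι y ∈ ι(S). [folklore] -/
theorem mem_rng (ι : S ↪ B4.Idx Ω N) (y : S) : ι y ∈ rng ι :=
  Finset.mem_map_of_mem ι (Finset.mem_univ y)

/-- S ≃ ι(S). [folklore] -/
noncomputable def rngEquiv (ι : S ↪ B4.Idx Ω N) : S ≃ ↥(rng ι) :=
  Equiv.ofBijective (fun y => ⟨ι y, mem_rng ι y⟩)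
    ⟨fun y y' h => ι.injective (congrArg Subtype.val h), fun f => by
      obtain ⟨y, -, hy⟩ := Finset.mem_map.mp f.2
      exact ⟨y, Subtype.ext hy⟩⟩

/-- The inverse of `rngEquiv` followed by ι is the inclusion. [folklore] -/
theorem ι_rngEquiv_symm (ι : S ↪ B4.Idx Ω N) (f : rng ι) : ι ((rngEquiv ι).symm f) = f :=
  congrArg Subtype.val ((rngEquiv ι).apply_symm_apply f)

/-- `rngEquiv⁻¹ ⟨ι y, _⟩ = y`. [folklore] -/
theorem rngEquiv_symm_mk (ι : S ↪ B4.Idx Ω N) (y : S) : (rngEquiv ι).symm ⟨ι y, mem_rng ι y⟩ = y :=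
  (rngEquiv ι).symm_apply_apply y

variable (ι : S ↪ B4.Idx Ω N) (w : S → ℝ) (M : Matrix S S ℝ) (γ : ℝ)

/-- THE ENCODED OPERATOR on L²(Ω; ℝ^N) of [3]: D M D⁻¹ transported to ι(S) ⊆ Ω × Fin N, γ·(identity) on the unused
indices, no coupling. [cite: Balaban1984PropagatorsII, (2.69) p.235 + p.237] -/
noncomputable def encode : Matrix (B4.Idx Ω N) (B4.Idx Ω N) ℝ :=
  B6BondElimination.pad (rng ι) ((conj w M).submatrix (rngEquiv ι).symm (rngEquiv ι).symm) γ

/-- Entries of the encoded operator on ι(S) × ι(S). [folklore] -/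
theorem encode_apply (y y' : S) : encode ι w M γ (ι y) (ι y') = conj w M y y' := by
  rw [encode, B6BondElimination.pad_mem_mem _ _ (mem_rng ι y) (mem_rng ι y'), Matrix.submatrix_apply,
    rngEquiv_symm_mk, rngEquiv_symm_mk]

/-- KERNEL-CHECKED: the encoded operator satisfies condition (5.6) of [3] with (γ, √W·c + γ, δ) when M is weighted
self-adjoint, ≥ γ in the weighted product, and |M(y, y′)| ≤ c·e^{−δ|ιy − ιy′|}, weights in [1, W].
[cite: Balaban1983RegularityDecay, (5.6) p.594] -/
theorem encode_hyp56 (hw : ∀ y, 0 < w y) (h1 : ∀ y, 1 ≤ w y) {W : ℝ} (hW : ∀ y, w y ≤ W)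
    (hsymm : ∀ y y', w y * M y y' = w y' * M y' y) {c δ : ℝ} (hγ : 0 ≤ γ) (hc : 0 ≤ c)
    (hlow : ∀ u : S → ℝ, γ * ∑ y, w y * u y ^ 2 ≤ ∑ y, w y * u y * (M *ᵥ u) y)
    (hdec : ∀ y y', |M y y'| ≤
      c * Real.exp (-(δ * dist ((ι y).1 : Fin d → ℤ) ((ι y').1 : Fin d → ℤ)))) :
    B4.Hyp56 Ω (encode ι w M γ) γ (Real.sqrt W * c + γ) δ := by
  refine B6BondElimination.hyp56_pad hγ (by positivity) ?_ ?_ ?_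
  · exact (conj_isSymm hw hsymm).submatrix _
  · intro v
    have key : ∀ y, ((conj w M).submatrix (rngEquiv ι).symm (rngEquiv ι).symm *ᵥ v) (rngEquiv ι y) =
        (conj w M *ᵥ fun y' => v (rngEquiv ι y')) y := by
      intro y
      simp only [Matrix.mulVec, dotProduct, Matrix.submatrix_apply, Equiv.symm_apply_apply]
      exact (Fintype.sum_equiv (rngEquiv ι) (fun y' => conj w M y y' * v (rngEquiv ι y'))
        (fun f' => conj w M y ((rngEquiv ι).symm f') * v f')
        (fun y' => by rw [Equiv.symm_apply_apply])).symm
    have hs1 : ∑ f, v f ^ 2 = ∑ y, v (rngEquiv ι y) ^ 2 :=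
      (Fintype.sum_equiv (rngEquiv ι) (fun y => v (rngEquiv ι y) ^ 2) (fun f => v f ^ 2) fun _ => rfl).symm
    have hs2 : ∑ f, v f * ((conj w M).submatrix (rngEquiv ι).symm (rngEquiv ι).symm *ᵥ v) f =
        ∑ y, v (rngEquiv ι y) * (conj w M *ᵥ fun y' => v (rngEquiv ι y')) y :=
      (Fintype.sum_equiv (rngEquiv ι)
        (fun y => v (rngEquiv ι y) * (conj w M *ᵥ fun y' => v (rngEquiv ι y')) y)
        (fun f => v f * ((conj w M).submatrix (rngEquiv ι).symm (rngEquiv ι).symm *ᵥ v) f)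
        (fun y => by rw [key])).symm
    rw [hs1, hs2]
    exact conj_lower hw hlow _
  · intro f f'
    rw [Matrix.submatrix_apply]
    have h := conj_decay hw h1 hW hdec ((rngEquiv ι).symm f) ((rngEquiv ι).symm f')
    rwa [ι_rngEquiv_symm, ι_rngEquiv_symm] at h

/-- KERNEL-CHECKED: on ι(S) × ι(S) the inverse of the encoded operator is D M⁻¹ D⁻¹ (block-diagonal inverse).
[folklore] -/
theorem encode_inv_apply [DecidableEq S] (hw : ∀ y, 0 < w y) (hM : IsUnit M.det) (hγ : γ ≠ 0) (y y' : S) :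
    (encode ι w M γ)⁻¹ (ι y) (ι y') = conj w M⁻¹ y y' := by
  have hsub : IsUnit ((conj w M).submatrix (rngEquiv ι).symm (rngEquiv ι).symm).det := by
    rw [Matrix.det_submatrix_equiv_self, det_conj hw]
    exact hM
  rw [encode, B6BondElimination.pad_inv _ hsub hγ,
    B6BondElimination.pad_mem_mem _ _ (mem_rng ι y) (mem_rng ι y'), Matrix.inv_submatrix_equiv,
    Matrix.submatrix_apply, rngEquiv_symm_mk, rngEquiv_symm_mk, conj_inv hw hM]

end Transport

/-! ## §3  Weighted sites: the printed data, `Encodes` discharged, the uniform decay -/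

section Sites

variable (d N : ℕ)

/-- ONE WEIGHTED SITE — the printed data at (S1) p. 237 / (S4) p. 248: a finite variable set S (the points, resp.
bonds, of 𝔅∩□ *"rescaled to unit scale"*), the weights of the product (2.69) on that scale, the operator M to which
[3] is applied ((Q′G′^ξ(□̃)²Q′*)↾_□, resp. (QG_□Q*)↾_□) as a matrix ((Mλ)(y) = Σ_{y′} M(y, y′)λ(y′)), and the placement
ι of the variables in Ω × Fin N, Ω ⊂ ℤ^d finite (position on the unit lattice, component). [cite: Balaban1984PropagatorsII, (2.69) p.235 + p.237 + p.248] -/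
structure WSite where
  /-- the variable set -/
  S : Type
  [instFintype : Fintype S]
  [instDecEq : DecidableEq S]
  /-- the weights of (2.69) on the unit scale -/
  w : S → ℝ
  /-- the operator, as a matrix -/
  M : Matrix S S ℝ
  /-- the index region of [3] -/
  Ω : Finset (Fin d → ℤ)
  /-- the placement (injective) -/
  ι : S ↪ B4.Idx Ω N

attribute [instance] WSite.instFintype WSite.instDecEq

variable {d N}

/-- THE PRINTED HYPOTHESES at one weighted site, constants (W, γ₀, c₀, δ₀): weights in [1, W] (W = L^d for (2.69) on
two scales); M self-adjoint for ⟨·,·⟩_w; the DISPLAYED lower bound ⟨u, Mu⟩_w ≥ γ₀‖u‖²_w ((2.78) with γ₀², (2.147) with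
γ₀); the ASSERTED kernel bound |M(y, y′)| ≤ c₀e^{−δ₀|ιy − ιy′|} (p. 237: *"a bound from above and an exponential decay
of the kernel … with the decay rate δ₀"*; p. 248: *"a similar bound from above and an exponential decay of a kernel of
the operator in (2.147)"* — not displayed in print; this field NAMES it). [cite: Balaban1984PropagatorsII, (2.78) p.236 + p.237 + (2.147) p.248] -/
structure WSite.Printed (U : WSite d N) (W γ₀ c₀ δ₀ : ℝ) : Prop where
  /-- weights ≥ 1 -/
  w_one : ∀ y, 1 ≤ U.w y
  /-- weights ≤ W -/
  w_le : ∀ y, U.w y ≤ W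
  /-- weighted self-adjointness -/
  symm : ∀ y y', U.w y * U.M y y' = U.w y' * U.M y' y
  /-- the displayed lower bound in the weighted product -/
  lower : ∀ u : U.S → ℝ, γ₀ * ∑ y, U.w y * u y ^ 2 ≤ ∑ y, U.w y * u y * (U.M *ᵥ u) y
  /-- the asserted kernel decay -/
  decay : ∀ y y', |U.M y y'| ≤
    c₀ * Real.exp (-(δ₀ * dist ((U.ι y).1 : Fin d → ℤ) ((U.ι y').1 : Fin d → ℤ)))

/-- Weights ≥ 1 are positive. [folklore] -/
theorem WSite.Printed.w_pos {U : WSite d N} {W γ₀ c₀ δ₀ : ℝ} (h : U.Printed W γ₀ c₀ δ₀) (y : U.S) :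
    0 < U.w y :=
  lt_of_lt_of_le one_pos (h.w_one y)

/-- THE ENCODING, performed: the use site of `…B6FromB4` defined by a weighted site — kernel = the matrix inverse M⁻¹,
distance = sup-distance of the encoded positions, encoded operator = `encode ι w M γ₀`, position map = first
component of ι. [cite: Balaban1984PropagatorsII, p.237] -/
noncomputable def WSite.toUseSite (U : WSite d N) (γ₀ : ℝ) : B6FromB4.UseSite d N where
  S := U.S
  ker := fun y y' => U.M⁻¹ y y'
  ρ := fun y y' => dist ((U.ι y).1 : Fin d → ℤ) ((U.ι y').1 : Fin d → ℤ)
  Ω := U.Ω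
  A := encode U.ι U.w U.M γ₀
  ι := fun y => (U.ι y).1

/-- KERNEL-CHECKED: the encoded operator of a printed weighted site satisfies (5.6) of [3] with (γ₀, √W·c₀ + γ₀, δ₀).
[cite: Balaban1983RegularityDecay, (5.6) p.594] -/
theorem WSite.hyp56 {U : WSite d N} {W γ₀ c₀ δ₀ : ℝ} (h : U.Printed W γ₀ c₀ δ₀) (hγ : 0 ≤ γ₀)
    (hc : 0 ≤ c₀) : B4.Hyp56 U.Ω (U.toUseSite γ₀).A γ₀ (Real.sqrt W * c₀ + γ₀) δ₀ :=
  encode_hyp56 U.ι U.w U.M γ₀ h.w_pos h.w_one h.w_le h.symm hγ hc h.lower h.decay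

/-- KERNEL-CHECKED — `UseSite.Encodes` DISCHARGED: a printed weighted site with γ₀ > 0 encodes with K = √W, σ = 1:
|M⁻¹(y, y′)| ≤ √W·Σ_{a,b}|A⁻¹((ιy)₁, a)((ιy′)₁, b)| (indeed M⁻¹(y, y′) = A⁻¹(ιy, ιy′)·√w(y′)/√w(y)) and the distances
agree. [cite: Balaban1984PropagatorsII, (2.69) p.235 + p.237] -/
theorem WSite.encodes {U : WSite d N} {W γ₀ c₀ δ₀ : ℝ} (h : U.Printed W γ₀ c₀ δ₀) (hγ : 0 < γ₀) :
    (U.toUseSite γ₀).Encodes (Real.sqrt W) 1 := by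
  have hw := h.w_pos
  have hdet : IsUnit U.M.det := by
    rw [← det_conj hw]
    exact B6BondElimination.isUnit_det_of_lower hγ (conj_lower hw h.lower)
  refine ⟨fun y y' => ?_, fun y y' => ?_⟩
  · show |U.M⁻¹ y y'| ≤ Real.sqrt W * ∑ a : Fin N, ∑ b : Fin N,
      |(encode U.ι U.w U.M γ₀)⁻¹ ((U.ι y).1, a) ((U.ι y').1, b)|
    have h1 : sw U.w y * U.M⁻¹ y y' = conj U.w U.M⁻¹ y y' * sw U.w y' := by
      rw [conj_apply, div_mul_eq_mul_div, mul_div_assoc, div_self (sw_ne hw y'), mul_one]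
    have ha : |U.M⁻¹ y y'| * sw U.w y = |conj U.w U.M⁻¹ y y'| * sw U.w y' := by
      have h2 := congrArg (fun t => |t|) h1
      simp only [abs_mul, abs_of_pos (sw_pos hw y), abs_of_pos (sw_pos hw y')] at h2
      rw [mul_comm]
      exact h2
    have h3 : |U.M⁻¹ y y'| ≤ |conj U.w U.M⁻¹ y y'| * Real.sqrt W :=
      calc |U.M⁻¹ y y'| = |U.M⁻¹ y y'| * 1 := (mul_one _).symm
        _ ≤ |U.M⁻¹ y y'| * sw U.w y := mul_le_mul_of_nonneg_left (one_le_sw h.w_one y) (abs_nonneg _)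
        _ = |conj U.w U.M⁻¹ y y'| * sw U.w y' := ha
        _ ≤ |conj U.w U.M⁻¹ y y'| * Real.sqrt W :=
            mul_le_mul_of_nonneg_left (sw_le h.w_le y') (abs_nonneg _)
    have h4 : conj U.w U.M⁻¹ y y' = (encode U.ι U.w U.M γ₀)⁻¹ (U.ι y) (U.ι y') :=
      (encode_inv_apply U.ι U.w U.M γ₀ hw hdet hγ.ne' y y').symm
    have h5 : |(encode U.ι U.w U.M γ₀)⁻¹ (U.ι y) (U.ι y')| ≤
        ∑ a : Fin N, ∑ b : Fin N, |(encode U.ι U.w U.M γ₀)⁻¹ ((U.ι y).1, a) ((U.ι y').1, b)| := by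
      have hb : |(encode U.ι U.w U.M γ₀)⁻¹ (U.ι y) (U.ι y')| ≤
          ∑ b : Fin N, |(encode U.ι U.w U.M γ₀)⁻¹ ((U.ι y).1, (U.ι y).2) ((U.ι y').1, b)| :=
        Finset.single_le_sum
          (f := fun b => |(encode U.ι U.w U.M γ₀)⁻¹ ((U.ι y).1, (U.ι y).2) ((U.ι y').1, b)|)
          (fun b _ => abs_nonneg _) (Finset.mem_univ (U.ι y').2)
      refine hb.trans ?_
      exact Finset.single_le_sum
        (f := fun a => ∑ b : Fin N, |(encode U.ι U.w U.M γ₀)⁻¹ ((U.ι y).1, a) ((U.ι y').1, b)|)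
        (fun a _ => Finset.sum_nonneg fun b _ => abs_nonneg _) (Finset.mem_univ (U.ι y).2)
    rw [h4] at h3
    calc |U.M⁻¹ y y'| ≤ |(encode U.ι U.w U.M γ₀)⁻¹ (U.ι y) (U.ι y')| * Real.sqrt W := h3
      _ ≤ (∑ a : Fin N, ∑ b : Fin N, |(encode U.ι U.w U.M γ₀)⁻¹ ((U.ι y).1, a) ((U.ι y').1, b)|) *
            Real.sqrt W := mul_le_mul_of_nonneg_right h5 (Real.sqrt_nonneg _)
      _ = _ := mul_comm _ _
  · show (1 : ℝ) * dist ((U.ι y).1 : Fin d → ℤ) ((U.ι y').1 : Fin d → ℤ) ≤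
      dist ((U.ι y).1 : Fin d → ℤ) ((U.ι y').1 : Fin d → ℤ)
    rw [one_mul]

/-- KERNEL-CHECKED, THE ENCODING STEP OF (S1)/(S4) AS A THEOREM: from the Sect. 5 Theorem of [3] (uniform reading)
there are ONE O(1) and ONE rate δ such that for EVERY weighted site with the printed hypotheses (W, γ₀, c₀, δ₀) —
any finite variable set, any weights in [1, W], any injective placement, any region Ω — the inverse operator decays:
|M⁻¹(y, y′)| ≤ O(1)e^{−δ|ιy − ιy′|}.  This is p. 237 *"We can use the theory developed in Sect. 5 [3] to conclude that
it has an exponential decay with a decay rate δ₁ depending on δ₀ and the bound γ₀"* with the encoding no longer a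
hypothesis. [cite: Balaban1984PropagatorsII, p.237 + p.248] -/
theorem weightedSites_uniform (h5 : B4.Sect5ThmUniform d N) {W γ₀ c₀ δ₀ : ℝ} (hγ : 0 < γ₀) (hc : 0 ≤ c₀)
    (hδ : 0 < δ₀) :
    ∃ C δ : ℝ, 0 < C ∧ 0 < δ ∧ ∀ U : WSite d N, U.Printed W γ₀ c₀ δ₀ →
      ∀ y y', |U.M⁻¹ y y'| ≤ C * Real.exp (-(δ * dist ((U.ι y).1 : Fin d → ℤ) ((U.ι y').1 : Fin d → ℤ))) := by
  obtain ⟨C, δ, hC, hδ', H⟩ := B6FromB4.useSites_uniform h5 (γ₀ := γ₀) (c₀ := Real.sqrt W * c₀ + γ₀)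
    (δ₀ := δ₀) (K := Real.sqrt W) (σ := 1) hγ (by positivity) hδ (Real.sqrt_nonneg W) one_pos
  refine ⟨C, δ, hC, hδ', fun U hU y y' => ?_⟩
  have h := H (U.toUseSite γ₀) (WSite.hyp56 hU hγ.le hc) (WSite.encodes hU hγ) y y'
  simpa [WSite.toUseSite] using h

/-- The weighted-measure kernel convention of B6 (kernel = matrix entry / w(y′), typing remark (a)) satisfies the same
bound. [folklore] -/
theorem weightedSites_uniform_kernel (h5 : B4.Sect5ThmUniform d N) {W γ₀ c₀ δ₀ : ℝ} (hγ : 0 < γ₀)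
    (hc : 0 ≤ c₀) (hδ : 0 < δ₀) :
    ∃ C δ : ℝ, 0 < C ∧ 0 < δ ∧ ∀ U : WSite d N, U.Printed W γ₀ c₀ δ₀ →
      ∀ y y', |U.M⁻¹ y y' / U.w y'| ≤
        C * Real.exp (-(δ * dist ((U.ι y).1 : Fin d → ℤ) ((U.ι y').1 : Fin d → ℤ))) := by
  obtain ⟨C, δ, hC, hδ', H⟩ := weightedSites_uniform h5 (W := W) hγ hc hδ
  exact ⟨C, δ, hC, hδ', fun U hU y y' => (abs_div_weight_le (hU.w_one y')).trans (H U hU y y')⟩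

end Sites

/-! ## §4  The (S1)/(S4) family statements of `…B6FromB4` with the encoding discharged -/

section Families

variable (d N : ℕ)

/-- ONE CUBE INSTANCE (geometry, j, □) in weighted form: a weighted site + the scaling factor t = L^jη and the
original-scale kernel (C_□ of (2.70), resp. of (2.143)). [cite: Balaban1984PropagatorsII, (2.70) p.235 + (2.80) p.237 + (2.143)–(2.144) p.248] -/
structure WCubeSite extends WSite d N where
  /-- L^jη -/
  t : ℝ
  /-- the kernel of C_□ on the same variables (original scale) -/
  kerCube : S → S → ℝ

variable {d N}

/-- The cube site of `…B6FromB4` defined by a weighted cube site. [folklore] -/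
noncomputable def WCubeSite.toCubeSite (U : WCubeSite d N) (γ₀ : ℝ) : B6FromB4.CubeSite d N where
  toUseSite := U.toWSite.toUseSite γ₀
  t := U.t
  kerCube := U.kerCube

/-- KERNEL-CHECKED, (S1) with the encoding performed: `B4.Sect5ThmUniform` + for every (geometry, j, □) the PRINTED
weighted hypotheses (weights of (2.69) in [1, W]; (Q′G′^ξ(□̃)²Q′*)↾_□ self-adjoint and ≥ γ₀² in that product — p. 236
(2.78) verbatim: *"⟨ω, Q′G′^ξ(□̃)²Q′*ω⟩ ≥ γ₀²‖ω₁‖² = γ₀²‖Q″*ω‖² ≥ γ₀²‖ω‖². (2.78)"*;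
its kernel ≤ c₀e^{−δ₀|y−y′|}, asserted p. 237) + the scaling law (2.80) ⟹ (2.79) ∧ (2.81) with ONE O(1), ONE δ₁ for
the whole family (`B6FromB4.Ineq279_281` of the induced cube sites; kernel = matrix inverse, distance = sup-distance
of the encoded unit-lattice positions). [cite: Balaban1984PropagatorsII, (2.78)–(2.81) pp.236–237] -/
theorem ineq279_281_of_weighted {I : Type} (h5 : B4.Sect5ThmUniform d N) (fam : I → WCubeSite d N)
    {W γ₀ c₀ δ₀ : ℝ} (hγ : 0 < γ₀) (hc : 0 ≤ c₀) (hδ : 0 < δ₀)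
    (h278 : ∀ i, (fam i).toWSite.Printed W (γ₀ ^ 2) c₀ δ₀)
    (ht : ∀ i, 0 < (fam i).t)
    (h280 : ∀ i y y', (fam i).kerCube y y' = (fam i).t ^ (-((d : ℝ) + 4)) * (fam i).M⁻¹ y y') :
    ∃ C δ₁ : ℝ, 0 < C ∧ 0 < δ₁ ∧
      B6FromB4.Ineq279_281 (fun i => (fam i).toCubeSite (γ₀ ^ 2)) C δ₁ :=
  B6FromB4.ineq279_281_of_sect5 h5 (fun i => (fam i).toCubeSite (γ₀ ^ 2))
    (c₀ := Real.sqrt W * c₀ + γ₀ ^ 2) (K := Real.sqrt W) (σ := 1) hγ (by positivity) hδ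
    (Real.sqrt_nonneg W) one_pos
    (fun i => by
      have h := WSite.hyp56 (h278 i) (pow_pos hγ 2).le hc
      exact h)
    (fun i => WSite.encodes (h278 i) (pow_pos hγ 2)) ht
    (fun i y y' => h280 i y y')

/-- KERNEL-CHECKED, (S4) with the encoding performed: `B4.Sect5ThmUniform` + for every (geometry, j, □) the PRINTED
weighted hypotheses ((QG_□Q*)↾_□ on the unit scale: self-adjoint and ≥ γ₀ in the product of (2.144), (2.147); kernel
≤ c₀e^{−δ₀|b−b′|}, asserted p. 248) + the bond scaling law of exponent d + 2 ((2.144)) ⟹ (2.148) with ONE O(1), ONE δ₄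
for the whole family (`B6FromB4.Ineq2148` of the induced cube sites). [cite: Balaban1984PropagatorsII, (2.144)–(2.148) pp.248–249] -/
theorem ineq2148_of_weighted {I : Type} (h5 : B4.Sect5ThmUniform d N) (fam : I → WCubeSite d N)
    {W γ₀ c₀ δ₀ : ℝ} (hγ : 0 < γ₀) (hc : 0 ≤ c₀) (hδ : 0 < δ₀)
    (h2147 : ∀ i, (fam i).toWSite.Printed W γ₀ c₀ δ₀)
    (ht : ∀ i, 0 < (fam i).t)
    (h2144 : ∀ i y y', (fam i).kerCube y y' = (fam i).t ^ (-((d : ℝ) + 2)) * (fam i).M⁻¹ y y') :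
    ∃ C δ₄ : ℝ, 0 < C ∧ 0 < δ₄ ∧
      B6FromB4.Ineq2148 (fun i => (fam i).toCubeSite γ₀) C δ₄ :=
  B6FromB4.ineq2148_of_sect5 h5 (fun i => (fam i).toCubeSite γ₀)
    (c₀ := Real.sqrt W * c₀ + γ₀) (K := Real.sqrt W) (σ := 1) hγ (by positivity) hδ
    (Real.sqrt_nonneg W) one_pos
    (fun i => by
      have h := WSite.hyp56 (h2147 i) hγ.le hc
      exact h)
    (fun i => WSite.encodes (h2147 i) hγ) ht
    (fun i y y' => h2144 i y y')

end Families

/-! ## §5  Ledger of this module (for the cell's GAPS / DIVERGENCE rows)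

* G-B6-05a residual "encoding" / G-B6-12 (ii): `UseSite.Encodes` of `…B6FromB4` DISCHARGED for every weighted site
  (`WSite.encodes`), together with the (5.6) instance of the encoded operator from the printed weighted hypotheses
  (`WSite.hyp56`); consequences `weightedSites_uniform`, `ineq279_281_of_weighted`, `ineq2148_of_weighted`.
* Still NAMED (fields of `WSite.Printed`, hypotheses `ht`/`h280`/`h2144`): the kernel decay of the operators
  (asserted in print), the scaling laws (2.80)/(2.144), and — outside this module — (2.81) ⇒ Prop. 2.3, (2.148) ⇒
  Prop. 2.7, the lower bounds (2.78)/(2.147) themselves (displayed; cf. `…B6AdjointAveraging` for (2.147)'s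
  undisplayed sentence).
-/

end Literature.MathematicalPhysics.QuantumFieldTheory.Balaban1983to89.B6WeightedEncoding
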